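import Literature.Probability.RandomPlanarGeometry.SLERestrictionProcessesKappa
import Literature.Probability.RandomPlanarGeometry.SLERestrictionStepAlive
import Literature.Probability.RandomPlanarGeometry.LoewnerPointCocycle
import Literature.Probability.RandomPlanarGeometry.LoewnerGrowth
import Literature.Probability.RandomPlanarGeometry.SLEKappaRhoFlow
import Literature.Probability.RandomPlanarGeometry.LoewnerFlow
import HarnessLib

/-!
# Concatenated drivers: a tube-steered past glued to a future that keeps the slid hull alive
# (line `boundary-area-law`, L3c helper)

Line `boundary-area-law` of the crux `SubseqIdentification` (stmt-CriticalPhenomena-0783), lead c5,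
stub L3c `stub_compensatorEssUnbounded_of_tube` (from the deterministic tube statement to the
essential unboundedness of the LSW compensator). This file is the DETERMINISTIC half of the Markov
step: for continuous paths `P, Q : C([0,∞), ℝ)` and the concatenation
`c = concat S (stop S P, Q)` of `BrownianPathFreezing` (follow `P` up to `S`, then add the
increments of `Q`), the SLE-type driver `drvK κ c` agrees with `drvK κ P` on `[0, S]` and its
increments after `S` are `drvK κ Q` (`drvK_concat_of_le_c5`, `incrDriving_drvK_concat_c5`).
Consequently (`forall_disjoint_closedHull_concat_c5`): if the tube hypothesis of the line keeps the
`*`-hull `A` alive at `S` for every driver `η`-close to the centre `U` on `[0, S]`, if `drvK κ P`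
is in that tube, and if `drvK κ Q` keeps EVERY point (real points included) of the slid hull
`A_S − W_S` of `drvK κ P` alive at all times, then the hulls of `drvK κ c` never reach `A`.
The one new piece of Loewner calculus is the backward point cocycle WITHOUT the hypothesis
`z ∈ ℍ` (`coe_add_lt_swallowingTime_of_lt_c5`, the tree's `Loewner.coe_add_lt_swallowingTime`
whose proof only uses `t < T_z`): real points of `A` are handled by the same extension argument.

References: G. F. Lawler, *Conformally Invariant Processes in the Plane* (2005), Rem. 4.9 (the
cocycle `g_{s+t} = g_{s,s+t} ∘ g_s`); D. Revuz, M. Yor (1999), Ch. III Prop. (3.5). No named fact is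
used.
-/

noncomputable section

open MeasureTheory Filter Topology Set Metric
open scoped NNReal ENNReal
open Literature.Probability.RandomPlanarGeometry
open Literature.Probability.RandomPlanarGeometry.PathOps

namespace Summit.CriticalPhenomena.SAWScalingLimit.Theorems.SubseqIdentification.BoundaryAreaLaw

open Loewner

/-! ### The backward point cocycle for every starting point -/

/-- **Backward cocycle of swallowing times, any starting point (real points included).** If `z`
is alive at time `t` under the continuous driver `W` and its image `g_t(z)` is alive at time `r`
under the shifted driver `W(t + ·)`, then `z` is alive at time `t + r`. (If `T_z = τ ≤ t + r`,
the flow of `z` comes arbitrarily close to the driver before `τ`, necessarily after `t`; but on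
`[t, τ)` it is the shifted maximal flow, alive beyond `τ − t` and bounded away from `W(t + ·)`
there.) Adapted from the tree's `Loewner.coe_add_lt_swallowingTime` (stated there for `z ∈ H_t`).
[cite: Lawler2005, Rem. 4.9] -/
theorem coe_add_lt_swallowingTime_of_lt_c5 {W : ℝ≥0 → ℝ} (hW : Continuous W) {z : ℂ} {t r : ℝ≥0}
    (ht : (t : WithTop ℝ≥0) < swallowingTime W z)
    (hr : (r : WithTop ℝ≥0) < swallowingTime (fun u ↦ W (t + u)) (map W t z)) :
    ((t + r : ℝ≥0) : WithTop ℝ≥0) < swallowingTime W z := by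
  by_contra hle
  rw [not_lt] at hle
  obtain ⟨τ, hτ⟩ : ∃ τ : ℝ≥0, swallowingTime W z = τ := by
    induction hT : swallowingTime W z with
    | top => exact absurd hle (by rw [hT]; exact not_le.2 (WithTop.coe_lt_top _))
    | coe b => exact ⟨b, rfl⟩
  rw [hτ] at hle ht
  have htτ : t < τ := WithTop.coe_lt_coe.1 ht
  have hτtr : τ ≤ t + r := WithTop.coe_le_coe.1 hle
  -- the shifted maximal solution from `w = g_t(z)`
  set θ : ℝ≥0 → ℝ := fun u ↦ W (t + u) with hθ
  have hθc : Continuous θ := continuous_shift W hW t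
  set w := map W t z with hw
  have hwz : w ≠ θ 0 := by
    have := ne_driving_of_lt_swallowingTime hr
    simpa [hθ] using this
  obtain ⟨G', hG'⟩ := exists_isSolution_swallowingTime_holds hθc hwz
  -- the real interval `[0, τ - t]` lies inside the lifetime of `G'`
  have htτ' : (t : ℝ) < τ := by exact_mod_cast htτ
  have hb0 : 0 ≤ (τ : ℝ) - t := by linarith
  have hbT : ((((τ : ℝ) - t).toNNReal) : WithTop ℝ≥0) < swallowingTime θ w := by
    refine lt_of_le_of_lt ?_ hr
    rw [WithTop.coe_le_coe, ← NNReal.coe_le_coe, Real.coe_toNNReal _ hb0]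
    have : (τ : ℝ) ≤ t + r := by exact_mod_cast hτtr
    linarith
  obtain ⟨δ, hδ, hfar⟩ := hG'.exists_le_norm_sub hθc hb0 hbT
  -- before `τ` the flow of `z` comes `δ`-close to the driver, at some time `ρ ∈ [t, τ)`
  obtain ⟨ρ, htρ, hρτ, hclose⟩ :=
    exists_norm_map_sub_lt_of_swallowingTime_eq hW hτ htτ (NNReal.coe_pos.2 hδ)
  -- but there the flow of `z` is the shifted flow of `w`, which is `δ`-far from the driver
  set u : ℝ≥0 := ρ - t with hu
  have htu : t + u = ρ := add_tsub_cancel_of_le htρ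
  have huτ : ((t + u : ℝ≥0) : WithTop ℝ≥0) < swallowingTime W z := by
    rw [htu, hτ]; exact_mod_cast hρτ
  have hcoc := map_add hW huτ
  rw [htu] at hcoc
  have huT : (u : WithTop ℝ≥0) < swallowingTime θ w := hcoc.1
  have hmap : map W ρ z = G' u := by
    rw [hcoc.2]
    exact map_eq_of_isSolution hθc hG' huT
  have humem : (u : ℝ) ∈ Icc 0 ((τ : ℝ) - t) := by
    refine ⟨u.coe_nonneg, ?_⟩
    have h1 : (u : ℝ) = ρ - t := by
      rw [hu, NNReal.coe_sub htρ]
    have h2 : (ρ : ℝ) < τ := by exact_mod_cast hρτ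
    linarith
  have hfar' := hfar u humem
  rw [Real.toNNReal_coe] at hfar'
  have hWρ : W ρ = θ u := by simp [hθ, htu]
  rw [hmap, hWρ] at hclose
  exact absurd hclose (not_lt.2 hfar')

/-! ### The driver of a concatenated path -/

/-- On `[0, S]` the driver of `concat S (stop S P, Q)` is the driver of `P`. [folklore] -/
theorem drvK_concat_of_le_c5 (κ : ℝ≥0) (S : ℝ≥0) (P Q : C(ℝ≥0, ℝ)) {r : ℝ≥0} (hr : r ≤ S) :
    drvK κ (concat S (stop S P, Q)) r = drvK κ P r := by
  simp only [drvK, concat_apply_of_le S _ _ hr, concat_apply_of_le S _ _ (zero_le : (0 : ℝ≥0) ≤ S), stop_apply,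
    min_eq_left hr, min_eq_left (zero_le : (0 : ℝ≥0) ≤ S)]

/-- After `S` the driver of `concat S (stop S P, Q)` is `drvK κ P S` plus the driver of `Q`. [folklore] -/
theorem drvK_concat_add_c5 (κ : ℝ≥0) (S : ℝ≥0) (P Q : C(ℝ≥0, ℝ)) (u : ℝ≥0) :
    drvK κ (concat S (stop S P, Q)) (S + u) = drvK κ P S + drvK κ Q u := by
  have h0 : concat S (stop S P, Q) 0 = P 0 := by
    rw [concat_apply_of_le S _ _ (zero_le : (0 : ℝ≥0) ≤ S), stop_apply, min_eq_left (zero_le : (0 : ℝ≥0) ≤ S)]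
  have hS : concat S (stop S P, Q) (S + u) = P S + (Q u - Q 0) := by
    rw [concat_apply]
    split_ifs with h
    · have hu0 : u = 0 := le_antisymm (by simpa using h) bot_le
      simp [stop_apply, hu0]
    · simp [stop_apply, add_tsub_cancel_left]
  simp only [drvK, hS, h0]
  ring

/-- The increments after `S` of the driver of `concat S (stop S P, Q)` are the driver of `Q`. [folklore] -/
theorem incrDriving_drvK_concat_c5 (κ : ℝ≥0) (S : ℝ≥0) (P Q : C(ℝ≥0, ℝ)) :
    incrDriving (drvK κ (concat S (stop S P, Q))) S = drvK κ Q := by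
  funext u
  have hS : drvK κ (concat S (stop S P, Q)) S = drvK κ P S := by
    have := drvK_concat_add_c5 κ S P Q 0
    rwa [add_zero, drvK_zero, add_zero] at this
  rw [incrDriving_apply, drvK_concat_add_c5, hS]
  ring

/-- The shifted driver `W(S + ·)` of the concatenation, as increments plus the value at `S`. [folklore] -/
theorem shift_drvK_concat_c5 (κ : ℝ≥0) (S : ℝ≥0) (P Q : C(ℝ≥0, ℝ)) :
    (fun u ↦ drvK κ (concat S (stop S P, Q)) (S + u)) = fun u ↦ drvK κ Q u + drvK κ P S := by
  funext u
  rw [drvK_concat_add_c5]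
  ring

/-! ### Aliveness of `A` under the concatenated driver -/

/-- Aliveness of every point at a time gives disjointness of the closed hull. [folklore] -/
theorem disjoint_closedHull_of_forall_lt_c5 {W : ℝ≥0 → ℝ} {A : Set ℂ} {t : ℝ≥0}
    (h : ∀ z ∈ A, (t : WithTop ℝ≥0) < swallowingTime W z) : Disjoint (closedHull W t) A := by
  rw [Set.disjoint_left]
  intro z hz hzA
  exact (not_le.2 (h z hzA)) hz.2

/-- **The hulls of the concatenated driver never reach `A`.** Let the tube hypothesis of the line
hold for `(A, U, S, η)`: every continuous driver `η`-close to `U` on `[0, S]` keeps all of `A`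
alive at `S`. If `drvK κ P` is in the tube and `drvK κ Q` keeps every point of the slid hull
`A_S − W_S` of `drvK κ P` alive at all times, then for the concatenated path
`c = concat S (stop S P, Q)` the closed hulls of `drvK κ c` miss `A` at every time: up to `S`
because `drvK κ c = drvK κ P` there (tube), after `S` by the point cocycle, since the increments
of `drvK κ c` after `S` are `drvK κ Q` and the Loewner maps at `S` agree (locality
`Loewner.map_eq_of_eqOn`). [cite: Lawler2005, Rem. 4.9] -/
theorem forall_disjoint_closedHull_concat_c5 (κ : ℝ≥0) {A : Set ℂ} {U : ℝ≥0 → ℝ} {S : ℝ≥0} {η : ℝ}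
    (htube : ∀ (W : ℝ≥0 → ℝ), Continuous W → (∀ s : ℝ≥0, s ≤ S → |W s - U s| ≤ η) →
      ∀ z ∈ A, (S : WithTop ℝ≥0) < swallowingTime W z)
    {P Q : C(ℝ≥0, ℝ)} (hP : ∀ s : ℝ≥0, s ≤ S → |drvK κ P s - U s| ≤ η)
    (hQ : ∀ (u : ℝ≥0), ∀ w ∈ slidHull (drvK κ P) A S, (u : WithTop ℝ≥0) < swallowingTime (drvK κ Q) w) :
    ∀ t, Disjoint (closedHull (drvK κ (concat S (stop S P, Q))) t) A := by
  set c := concat S (stop S P, Q) with hc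
  have hWc : Continuous (drvK κ c) := continuous_drvK κ c
  have hWP : Continuous (drvK κ P) := continuous_drvK κ P
  have heq : ∀ s : ℝ≥0, s ≤ S → drvK κ c s = drvK κ P s := fun s hs ↦ drvK_concat_of_le_c5 κ S P Q hs
  have htubec : ∀ s : ℝ≥0, s ≤ S → |drvK κ c s - U s| ≤ η := fun s hs ↦ by
    rw [heq s hs]; exact hP s hs
  have hSalive : ∀ z ∈ A, (S : WithTop ℝ≥0) < swallowingTime (drvK κ c) z := htube _ hWc htubec
  intro t
  refine disjoint_closedHull_of_forall_lt_c5 fun z hz ↦ ?_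
  have hzS := hSalive z hz
  rcases le_or_gt t S with hts | hts
  · exact lt_of_le_of_lt (by exact_mod_cast hts) hzS
  · -- `t = S + u`; the image point at `S` lies in the slid hull of `drvK κ P`
    set u : ℝ≥0 := t - S with hu
    have hSu : S + u = t := add_tsub_cancel_of_le hts.le
    have hmapS : map (drvK κ c) S z = map (drvK κ P) S z :=
      (map_eq_of_eqOn hWc hWP heq hzS le_rfl).symm
    have hw : map (drvK κ c) S z - drvK κ c S ∈ slidHull (drvK κ P) A S := by
      rw [mem_slidHull_iff]
      exact ⟨z, hz, by rw [hmapS, heq S le_rfl]⟩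
    have hQ' := hQ u _ hw
    -- swallowing time under `drvK κ Q` = under the increments of `drvK κ c` after `S`
    have hincr : swallowingTime (drvK κ Q) (map (drvK κ c) S z - drvK κ c S) =
        swallowingTime (fun v ↦ drvK κ c (S + v)) (map (drvK κ c) S z) := by
      rw [← incrDriving_drvK_concat_c5 κ S P Q, ← centredMap]
      exact swallowingTime_incrDriving_centredMap (drvK κ c) S z
    rw [hincr] at hQ'
    have := coe_add_lt_swallowingTime_of_lt_c5 hWc hzS hQ'
    rwa [hSu] at this

/-- **Registered helper `forall_disjoint_closedHull_concat_registered`** (closed form of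
`forall_disjoint_closedHull_concat_c5`, explicit binders): tube-steered past + future keeping the
slid hull alive ⇒ the concatenated driver never reaches `A`. [cite: Lawler2005, Rem. 4.9] -/
theorem forall_disjoint_closedHull_concat_registered :
    ∀ (κ : ℝ≥0) (A : Set ℂ) (U : ℝ≥0 → ℝ) (S : ℝ≥0) (η : ℝ),
      (∀ (W : ℝ≥0 → ℝ), Continuous W → (∀ s : ℝ≥0, s ≤ S → |W s - U s| ≤ η) →
        ∀ z ∈ A, (S : WithTop ℝ≥0) < Loewner.swallowingTime W z) →
      ∀ (P Q : C(ℝ≥0, ℝ)),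
        (∀ s : ℝ≥0, s ≤ S → |Literature.Probability.RandomPlanarGeometry.drvK κ P s - U s| ≤ η) →
        (∀ (u : ℝ≥0), ∀ w ∈ Loewner.slidHull (Literature.Probability.RandomPlanarGeometry.drvK κ P) A S,
          (u : WithTop ℝ≥0) < Loewner.swallowingTime (Literature.Probability.RandomPlanarGeometry.drvK κ Q) w) →
        ∀ t : ℝ≥0, Disjoint (Loewner.closedHull (Literature.Probability.RandomPlanarGeometry.drvK κ
          (Literature.Probability.RandomPlanarGeometry.PathOps.concat S
            (Literature.Probability.RandomPlanarGeometry.PathOps.stop S P, Q))) t) A :=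
  fun κ _ _ _ _ htube _ _ hP hQ ↦ forall_disjoint_closedHull_concat_c5 κ htube hP hQ

end Summit.CriticalPhenomena.SAWScalingLimit.Theorems.SubseqIdentification.BoundaryAreaLaw

end
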